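import Literature.Computability.AlgebraicComplexity.BI17Ex56ShapeSeven
import Literature.Computability.AlgebraicComplexity.BI17Ex55Proofs

set_option linter.dupNamespace false
set_option autoImplicit false

/-!
# Universal occurrence — monotonicity of the rectangular Kronecker coefficients `k_m(δ)` (decomp-mm · lens 3 · gen 40)

Route `route-MatrixMultiplication-ObstructionDescent` (sub-problem `MatrixMultiplication`, `ω(ℂ) = 2`); SUPPORT for the crux
`NoOccurrenceObstruction` (item `stmt-MatrixMultiplication-29040`) through the universal-occurrence ladder `u(N)` of NODE-g39/g40
(`UOCC(R,N)`: every type occurring for SOME tensor of format `N × N × N` occurs for `⟨R⟩`).  Nothing here proves `ω = 2` or closes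
an item; no `def`, no `sorry`, standard axioms.

**Why this file.**  The gen-40 hypersurface blindness law (`ObstructionDescentUniversalOccurrenceHypersurfaceLaw.lean`) makes the
occurrence obstructions of a format whose secant variety `σ_r` is a HYPERSURFACE with equation `F` (an `SL³`-invariant of degree
`mδ_F`) go blind at `r` as soon as the invariant space of degree `mδ_F` has dimension `k_m(δ_F) ≥ 2` (an "escape partner" `F'`
with `F ∤ F'` exists).  Since `δ_F` is unknown, one needs `k_m(δ) ≥ 2` for ALL admissible `δ`; this file supplies the
structural half:

* §1 `mul_mem_sl3InvariantsOfDegree` — invariants multiply (degrees add);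
  **`kronRect_le_kronRect_add_of_pos`** — `k_m(b) > 0 ⟹ k_m(a) ≤ k_m(a+b)` (multiplication by a non-zero invariant `G` of
  degree `mb` is an injective linear map `O(⊗³)^{SL³}_{ma} → O(⊗³)^{SL³}_{m(a+b)}` of finite-dimensional spaces whose dimensions
  are `k_m(a)`, `k_m(a+b)` by `finrank_sl3InvariantsOfDegree_eq_kronRect`, BI 2017 §5);
* §2 format `3`: **`two_le_kronRect_three_iff`** — `k_3(δ) ≥ 2 ⟺ δ = 4 ∨ δ ≥ 6`, from the table `k_3(0..12)` of BI 2017 Ex. 5.5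
  (`BI2017_ex_5_5_holds`) and `k_3(δ) > 0 (δ ≠ 1)`; this is the kernel form of the census correction I165/E1 to NODE-g39 §8.3
  (`g(κ_n) = k_3(n) ≥ 2` exactly for the odd `n ≥ 7` used there — the closed form `k_3(n) = #{2a+3b+4c = n}` (Vinberg 1976: the
  invariant ring `ℂ[ℂ³⊗ℂ³⊗ℂ³]^{SL₃³}` is free on generators of degrees `6, 9, 12`) is NOT claimed here);
* §3 format `7`: **`fourteen_le_kronRect_seven_of_eight_le`** — `k_7(δ) ≥ k_7(4) = 14` for `δ ≥ 8` (atoms `k_7(4) = 14`,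
  `k_7(δ-4) > 0`, both in the tree), and **`two_le_kronRect_seven_of_atoms`** — `k_7(δ) ≥ 2` for every `δ ≥ 4` GIVEN the two
  remaining atoms `k_7(6) ≥ 2`, `k_7(7) ≥ 2` (exact values by two independent character engines, pkg-ObstructionDescent-g40/calc:
  `k_7(6) = 438744` — the value printed in Amanov–Yeliussizov 2022, Table 4 — and `k_7(7) = 125250433`; not kernel facts).

[cite: BurgisserIkenmeyer2017, §5 eq. (5.1)–(5.2), Ex. 5.5, Ex. 5.6] [cite: AmanovYeliussizov2022, §9 Table 4]
-/

namespace Summit.MatrixMultiplication.MatrixMultiplication.Theorems.ObstructionCalculus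

open Literature.Computability.AlgebraicComplexity

/-! ### §1 Invariants multiply; `k_m` is monotone along positive steps -/

/-- Products of `SL³`-invariants of degrees `a`, `b` are `SL³`-invariants of degree `a + b`.
[cite: BurgisserIkenmeyer2017, §5 (the invariant ring is graded)] -/
theorem mul_mem_sl3InvariantsOfDegree {ι k : Type*} [Fintype ι] [DecidableEq ι] [Field k] {a b : ℕ}
    {F G : MvPolynomial (ι × ι × ι) k} (hF : F ∈ sl3InvariantsOfDegree ι k a) (hG : G ∈ sl3InvariantsOfDegree ι k b) :
    F * G ∈ sl3InvariantsOfDegree ι k (a + b) := by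
  rw [mem_sl3InvariantsOfDegree_iff] at hF hG ⊢
  exact ⟨hF.1.mul hG.1, hF.2.mul hG.2⟩

/-- **Monotonicity of `k_m`.**  If `k_m(b) > 0` then `k_m(a) ≤ k_m(a + b)`: multiplication by a non-zero invariant of degree `mb`
embeds `O(⊗³ℂ^m)^{SL³}_{ma}` into `O(⊗³ℂ^m)^{SL³}_{m(a+b)}` (the polynomial ring is a domain), and the dimensions are the
rectangular Kronecker coefficients. [cite: BurgisserIkenmeyer2017, §5 eq. (5.2)] -/
theorem kronRect_le_kronRect_add_of_pos {m a b : ℕ} (hb : 0 < kronRect ℂ m b) :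
    kronRect ℂ m a ≤ kronRect ℂ m (a + b) := by
  have hne : sl3InvariantsOfDegree (Fin m) ℂ (m * b) ≠ ⊥ :=
    (sl3InvariantsOfDegree_ne_bot_iff_kronRect_pos ℂ m b).2 hb
  obtain ⟨G, hG, hG0⟩ := (Submodule.ne_bot_iff _).1 hne
  haveI := finite_sl3InvariantsOfDegree ℂ m (a + b)
  let φ : ↥(sl3InvariantsOfDegree (Fin m) ℂ (m * a)) →ₗ[ℂ] ↥(sl3InvariantsOfDegree (Fin m) ℂ (m * (a + b))) :=
    { toFun := fun F => ⟨(F : MvPolynomial (Fin m × Fin m × Fin m) ℂ) * G, by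
        rw [Nat.mul_add]; exact mul_mem_sl3InvariantsOfDegree F.2 hG⟩
      map_add' := fun F₁ F₂ => by
        ext1
        simp [add_mul]
      map_smul' := fun c F => by
        ext1
        simp }
  have hinj : Function.Injective φ := by
    intro F₁ F₂ h
    have h' : (F₁ : MvPolynomial (Fin m × Fin m × Fin m) ℂ) * G = (F₂ : MvPolynomial _ ℂ) * G :=
      congrArg Subtype.val h
    exact Subtype.ext (mul_right_cancel₀ hG0 h')
  rw [← finrank_sl3InvariantsOfDegree_eq_kronRect ℂ m a, ← finrank_sl3InvariantsOfDegree_eq_kronRect ℂ m (a + b)]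
  exact LinearMap.finrank_le_finrank_of_injective hinj

/-- Iterated form: `k_m(b) > 0 ⟹ k_m(a) ≤ k_m(a + n·b)` for every `n`. [cite: BurgisserIkenmeyer2017, §5 eq. (5.2)] -/
theorem kronRect_le_kronRect_add_mul_of_pos {m a b : ℕ} (hb : 0 < kronRect ℂ m b) (n : ℕ) :
    kronRect ℂ m a ≤ kronRect ℂ m (a + n * b) := by
  induction n with
  | zero => simp
  | succ n ih =>
    calc kronRect ℂ m a ≤ kronRect ℂ m (a + n * b) := ih
      _ ≤ kronRect ℂ m (a + n * b + b) := kronRect_le_kronRect_add_of_pos hb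
      _ = kronRect ℂ m (a + (n + 1) * b) := by rw [Nat.succ_mul, Nat.add_assoc]

/-! ### §2 Format `3`: `k_3(δ) ≥ 2` exactly for `δ = 4` and `δ ≥ 6` -/

/-- `k_3(δ) ≥ k_3(4) = 2` for `δ ≥ 6` (`δ - 4 ≥ 2`, so `k_3(δ-4) > 0`). [cite: BurgisserIkenmeyer2017, Ex. 5.5] -/
theorem two_le_kronRect_three_of_six_le {δ : ℕ} (hδ : 6 ≤ δ) : 2 ≤ kronRect ℂ 3 δ := by
  have h4 : kronRect ℂ 3 4 = 2 := BI2017_ex_5_5_holds.1.2.2.2.2.1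
  have hpos : 0 < kronRect ℂ 3 (δ - 4) := kronRect_three_pos (by omega)
  have hmono := kronRect_le_kronRect_add_of_pos (m := 3) (a := 4) hpos
  rw [h4, show 4 + (δ - 4) = δ by omega] at hmono
  exact hmono

/-- **`k_3(δ) ≥ 2 ⟺ δ = 4 ∨ δ ≥ 6`** (the table `k_3(0..5) = 1,0,1,1,2,1` of BI 2017 Ex. 5.5 decides `δ ≤ 5`).  Kernel form of
the fact used in NODE-g39 §3/§5 (odd `n ≥ 7 ⟹ g(κ_n) = k_3(n) ≥ 2`). [cite: BurgisserIkenmeyer2017, Ex. 5.5] -/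
theorem two_le_kronRect_three_iff {δ : ℕ} : 2 ≤ kronRect ℂ 3 δ ↔ δ = 4 ∨ 6 ≤ δ := by
  obtain ⟨h0, h1, h2, h3, h4, h5, -⟩ := BI2017_ex_5_5_holds.1
  constructor
  · intro h
    by_contra hne
    push Not at hne
    have hδ : δ = 0 ∨ δ = 1 ∨ δ = 2 ∨ δ = 3 ∨ δ = 5 := by omega
    rcases hδ with rfl | rfl | rfl | rfl | rfl
    · rw [h0] at h; omega
    · rw [h1] at h; omega
    · rw [h2] at h; omega
    · rw [h3] at h; omega
    · rw [h5] at h; omega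
  · rintro (rfl | h)
    · rw [h4]
    · exact two_le_kronRect_three_of_six_le h

/-- In particular `k_3(n) ≥ 2` for every odd `n ≥ 7` — the escape-partner input of the odd-level blindness theorem of NODE-g39 §3
(`ObstructionDescentUniversalOccurrenceGradedEscape.lean`). [cite: BurgisserIkenmeyer2017, Ex. 5.5] -/
theorem two_le_kronRect_three_of_seven_le {n : ℕ} (hn : 7 ≤ n) : 2 ≤ kronRect ℂ 3 n :=
  two_le_kronRect_three_of_six_le (by omega)

/-! ### §3 Format `7`: `k_7(δ) ≥ 2` for `δ ≥ 4`, modulo the atoms `k_7(6) ≥ 2`, `k_7(7) ≥ 2` -/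

/-- `k_7(δ) ≥ k_7(4) = 14` for every `δ ≥ 8` (`k_7(δ - 4) > 0` by `kronRect_seven_pos_of_four_le`).
[cite: BurgisserIkenmeyer2017, Ex. 5.6] [cite: AmanovYeliussizov2022, §9 Table 4] -/
theorem fourteen_le_kronRect_seven_of_eight_le {δ : ℕ} (hδ : 8 ≤ δ) : 14 ≤ kronRect ℂ 7 δ := by
  have hpos : 0 < kronRect ℂ 7 (δ - 4) := kronRect_seven_pos_of_four_le (by omega)
  have hmono := kronRect_le_kronRect_add_of_pos (m := 7) (a := 4) hpos
  rw [kronRect_seven_four, show 4 + (δ - 4) = δ by omega] at hmono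
  exact hmono

/-- **`k_7(δ) ≥ 2` for all `δ ≥ 4`**, given the two atoms `k_7(6) ≥ 2` and `k_7(7) ≥ 2` (data: `k_7(6) = 438744`,
`k_7(7) = 125250433`, pkg-ObstructionDescent-g40/calc; `k_7(4) = 14` and `k_7(5) = 1456` are kernel facts).  This is the
escape-partner input of the hypersurface blindness law at the format `(18; 7,7,7)` for an equation of unknown degree `7δ`, `δ ≥ 4`.
[cite: BurgisserIkenmeyer2017, Ex. 5.6] [cite: AmanovYeliussizov2022, §9 Table 4] -/
theorem two_le_kronRect_seven_of_atoms (h6 : 2 ≤ kronRect ℂ 7 6) (h7 : 2 ≤ kronRect ℂ 7 7) {δ : ℕ} (hδ : 4 ≤ δ) :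
    2 ≤ kronRect ℂ 7 δ := by
  rcases Nat.lt_or_ge δ 8 with h | h
  · have hδ' : δ = 4 ∨ δ = 5 ∨ δ = 6 ∨ δ = 7 := by omega
    rcases hδ' with rfl | rfl | rfl | rfl
    · rw [kronRect_seven_four]; norm_num
    · rw [kronRect_seven_five]; norm_num
    · exact h6
    · exact h7
  · exact le_trans (by norm_num) (fourteen_le_kronRect_seven_of_eight_le h)

/-- The degree shape behind it, recorded for the memo: a NON-ZERO `SL³`-invariant of positive degree `D` on `ℂ⁷⊗ℂ⁷⊗ℂ⁷` has
`D = 7δ` with `δ ≥ 4` (`E(7) = {0} ∪ {28, 35, 42, …}`, `e(7) = 28`; tree theorems `BI2017_ex_5_6_shape_seven_holds`,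
`BI2017_ex_5_6_seven`). [cite: BurgisserIkenmeyer2017, Ex. 5.6] -/
theorem exists_eq_seven_mul_of_mem_genericTensorDegreeMonoid_seven {D : ℕ} (hD : D ∈ genericTensorDegreeMonoid (Fin 7) ℂ)
    (hD0 : D ≠ 0) : ∃ δ : ℕ, D = 7 * δ ∧ 4 ≤ δ := by
  have h := BI2017_ex_5_6_shape_seven_holds
  rw [h] at hD
  rcases hD with h0 | ⟨δ, hδ, hle⟩
  · exact absurd h0 hD0
  · refine ⟨δ, hδ, ?_⟩
    rw [BI2017_ex_5_6_seven] at hle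
    omega

end Summit.MatrixMultiplication.MatrixMultiplication.Theorems.ObstructionCalculus
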